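import Summits.HodgeConjecture.HodgeCM.Model.ArchKTypeOfSlotRec_1

/-! PORT of `HodgeCM/Model/ArchKTypeOfSlotRec.lean` (HodgeCMPerL run 82) — part 2: continuation of `Summits.HodgeConjecture.HodgeCM.Model.ArchKTypeOfSlotRec_1` (split at a top-level declaration boundary by port_pkg.py; scope re-opened below; declarations unchanged). -/

-- port_pkg: scope re-opened for this part (file-level context, then the namespace/section stack open at the cut)
set_option autoImplicit false
noncomputable section
open Filter Topology Complex
open NumberField NumberField.InfinitePlace NumberField.mixedEmbedding IsDedekindDomain MeasureTheory
open scoped Matrix TensorProduct Classical SchwartzMap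
open MulAction
open Literature.Geometry.ComplexHyperbolic.BallModel (U21 x₀ stabilizerEquivK21)
open Literature.NumberTheory.Automorphic.U21 (K21 matA sclD pPlus pPlus_apply)
open Literature.AlgebraicGeometry.HodgeTheory
open Literature.AlgebraicGeometry.ShimuraVarieties Literature.AlgebraicGeometry.ShimuraVarieties.BallForms
open Literature.NumberTheory.Automorphic Literature.NumberTheory.Weil1964
open Literature.RepresentationTheory.HeisenbergGroup (polar Heisenberg symplecticGroup ofSymplectic)
open Literature.RepresentationTheory.KonnoKonno2007 Literature.RepresentationTheory.KonnoKonno2007.RealDualPair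
open Literature.NumberTheory.GelbartRogawski1991 Literature.NumberTheory.GelbartRogawski1991.UnitaryDualPair
open Literature.Analysis.SegalBargmann Literature.Analysis.Distribution
open Literature.NumberTheory.Automorphic.PicardCM
open HodgeCM.Adelic HodgeCM.PerL34 HodgeCM.Model.HypCensus HodgeCM.Model.SupplyInstance HodgeCM.Model.ArchSideTerm
namespace HodgeCM.Model
section Record
variable (hHD : exists_isReal_hodgeModel) (hI : hodgePQ_independent_of_hodgeModel)
  (h₁ : BallQuotientUniformised)  (h₃ : CMAbelianVarietyRealised)
variable {L : CMField} {ι₁ : L →+* ℂ} (V : HermSpace3 L ι₁) (c : SeesawCtx L)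
  (hGR : (cmSplittingDatum (L : Type) finProdFinEquiv (frameD V) (frameD_real V) (frameD_ne V) (dW c.D) (dW_real c.D)
    (dW_ne c.D)).CompatibleSplitting)
  (hGR₀ : (cmSplittingDatum (L : Type) (e₁) (frameD V) (frameD_real V) (frameD_ne V) (lineVec (L : Type) (dW c.D 0))
    (fun _ => dW_real c.D 0) (fun _ => dW_ne c.D 0)).CompatibleSplitting)
  (hGR₁ : (cmSplittingDatum (L : Type) (e₁) (frameD V) (frameD_real V) (frameD_ne V) (lineVec (L : Type) (dW c.D 1))
    (fun _ => dW_real c.D 1) (fun _ => dW_ne c.D 1)).CompatibleSplitting)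
  (hGR₂ : (cmSplittingDatum (L : Type) (e₁) (frameD V) (frameD_real V) (frameD_ne V) (lineVec (L : Type) (dW' c.D 0))
    (fun _ => dW'_real c.D 0) (fun _ => dW'_ne c.D 0)).CompatibleSplitting)
  (hGR₃ : (cmSplittingDatum (L : Type) (e₁) (frameD V) (frameD_real V) (frameD_ne V) (lineVec (L : Type) (dW' c.D 1))
    (fun _ => dW'_real c.D 1) (fun _ => dW'_ne c.D 1)).CompatibleSplitting)
  (η : CMAdelic (L : Type) (frameD V) × CMAdelic (L : Type) (dW c.D) →* ℂˣ)
  (hη : ∀ γU ∈ CMRat (L : Type) (frameD V), ∀ γ ∈ CMRat (L : Type) (dW c.D), η (γU, γ) = 1)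
  (hηc : Continuous fun p => ((η p : ℂˣ) : ℂ))
  (h₁W : (∀ j, 0 < (ι₁ (dW c.D j)).re) ∨ ∀ j, (ι₁ (dW c.D j)).re < 0)
  (A : ∀ k : Fin 4, ArchLineInput V (lineRepD V c.D hGR hGR₀ hGR₁ hGR₂ hGR₃ η k))
  (hV : IsAnisotropic L V.Hm) (N : ℕ) (Γ₀ : Level V)
  (hlevel : ∀ δ ∈ levelImage hHD hI h₁ h₃ Γ₀ hV, ∃ x : (V.latticeModel printFact_unitaryCompact_holds).G,
    x ∈ (satLevelRegimeOf V hV Γ₀.K : Subgroup (V.latticeModel printFact_unitaryCompact_holds).G) ∧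
      (archSideOf V c hGR hGR₀ hGR₁ hGR₂ hGR₃ η hη hηc h₁W A).ιinf δ * x ∈ (V.latticeModel printFact_unitaryCompact_holds).Γ)
  (Φ₂ : SchwartzMap ((Fin 3 × {v : {v : InfinitePlace ↥(maximalRealSubfield L) // v.IsReal} // v ≠ cmPlace (L : Type) ι₁}) → ℝ) ℂ)
section DispatchRec
variable
  (eR₀' : PosIdx (cmXW (L : Type) (frameD V) (lineVec (L : Type) (dW c.D 0)) (fun _ => dW_real c.D 0) ι₁ (cmPlace (L : Type) ι₁)) ≃ Unit)
  (eS₀' : NegIdx (cmXW (L : Type) (frameD V) (lineVec (L : Type) (dW c.D 0)) (fun _ => dW_real c.D 0) ι₁ (cmPlace (L : Type) ι₁)) ≃ Empty)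
variable
  (ℓ₀₀' : Module.Dual ℂ (Fin 2 → ℂ))
  (arch₀₀' : blockFamilyOfAt (L : Type) e₁ (frameD V) (frameD_real V) (frameD_ne V) (lineVec (L : Type) (dW c.D 0))
      (fun _ => dW_real c.D 0) (fun _ => dW_ne c.D 0) ι₁ (blockPosEquiv V) (blockNegEquiv V) eR₀' eS₀' (degOnePDual Empty) Φ₂ ℓ₀₀' =
    (A 0).Φinf)
  (harch₀' : ∀ a : UnitaryGroup.arch (↥(maximalRealSubfield L)) L (IsCMField.complexConj L) 3 V.Hm,
    UnitaryGroup.archAt (↥(maximalRealSubfield L)) L (IsCMField.complexConj L) 3 V.Hm (UnitaryGroup.cmPlace (L : Type) ι₁)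
        (NumberField.complexConj_smul_infinitePlace (L : Type) _) (IsCMField.complexConj_ne_one (L : Type)) a = 1 →
    ∀ ℓ, ((archSideOf V c hGR hGR₀ hGR₁ hGR₂ hGR₃ η hη hηc h₁W A).P 0).ω
        (HodgeCM.Adelic.regimeEquiv L V.Hm hV
          (UnitaryGroup.archToAdelic (↥(maximalRealSubfield L)) L (IsCMField.complexConj L) 3 V.Hm a), 1)
        (testFun (↥(maximalRealSubfield L)) (Fin 3)
          (blockFamilyOfAt (L : Type) e₁ (frameD V) (frameD_real V) (frameD_ne V) (lineVec (L : Type) (dW c.D 0))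
            (fun _ => dW_real c.D 0) (fun _ => dW_ne c.D 0) ι₁ (blockPosEquiv V) (blockNegEquiv V) eR₀' eS₀' (degOnePDual Empty) Φ₂ ℓ)
          (A 0).x₀ N) =
      testFun (↥(maximalRealSubfield L)) (Fin 3)
        (blockFamilyOfAt (L : Type) e₁ (frameD V) (frameD_real V) (frameD_ne V) (lineVec (L : Type) (dW c.D 0))
          (fun _ => dW_real c.D 0) (fun _ => dW_ne c.D 0) ι₁ (blockPosEquiv V) (blockNegEquiv V) eR₀' eS₀' (degOnePDual Empty) Φ₂ ℓ) (A 0).x₀ N)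
  (hfin₀' : ∀ kf : UnitaryGroup.finAdelic (↥(maximalRealSubfield L)) L (IsCMField.complexConj L) 3 V.Hm, kf ∈ Γ₀.K →
    ∀ Φinf : 𝓢((Fin 3 → mixedSpace (↥(maximalRealSubfield L))), ℂ),
      ((archSideOf V c hGR hGR₀ hGR₁ hGR₂ hGR₃ η hη hηc h₁W A).P 0).ω
          (HodgeCM.Adelic.regimeEquiv L V.Hm hV
            (UnitaryGroup.finAdelicToAdelic (↥(maximalRealSubfield L)) L (IsCMField.complexConj L) 3 V.Hm kf), 1)
          (testFun (↥(maximalRealSubfield L)) (Fin 3) Φinf (A 0).x₀ N) =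
        testFun (↥(maximalRealSubfield L)) (Fin 3) Φinf (A 0).x₀ N)
  (hsec₀' : ∀ u : stabilizer U21 x₀,
    cmBlockSectionAt (L : Type) (frameD V) (frameD_real V) (frameD_ne V) (lineVec (L : Type) (dW c.D 0)) (fun _ => dW_real c.D 0)
        (fun _ => dW_ne c.D 0) ι₁ (cmPlace (L : Type) ι₁) (blockPosEquiv V) (blockNegEquiv V) eR₀' eS₀' (u21FrameEquiv (u : U21), 1) =
      (archSectionFrameOf V u, 1))
  (hχ₀' : ∀ u : stabilizer U21 x₀,
    ((lineScalar_zero V c.D hGR hGR₀ hGR₁ (eta₀ V c.D η) (u : U21) : ℂˣ) : ℂ) *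
        ((matA (stabilizerEquivK21.symm u)).det ^ (lineVacExponentsZero V c hGR₀ h₁W eR₀' eS₀').eP *
          sclD (stabilizerEquivK21.symm u) ^ (lineVacExponentsZero V c hGR₀ h₁W eR₀' eS₀').eQ) =
      star (sclD (stabilizerEquivK21.symm u)))
variable
  (eR₁' : PosIdx (cmXW (L : Type) (frameD V) (lineVec (L : Type) (dW c.D 1)) (fun _ => dW_real c.D 1) ι₁ (cmPlace (L : Type) ι₁)) ≃ Unit)
  (eS₁' : NegIdx (cmXW (L : Type) (frameD V) (lineVec (L : Type) (dW c.D 1)) (fun _ => dW_real c.D 1) ι₁ (cmPlace (L : Type) ι₁)) ≃ Empty)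
variable
  (ℓ₀₁' : Module.Dual ℂ (Fin 2 → ℂ))
  (arch₀₁' : blockFamilyOfAt (L : Type) e₁ (frameD V) (frameD_real V) (frameD_ne V) (lineVec (L : Type) (dW c.D 1))
      (fun _ => dW_real c.D 1) (fun _ => dW_ne c.D 1) ι₁ (blockPosEquiv V) (blockNegEquiv V) eR₁' eS₁' (degOnePDual Empty) Φ₂ ℓ₀₁' =
    (A 1).Φinf)
  (harch₁' : ∀ a : UnitaryGroup.arch (↥(maximalRealSubfield L)) L (IsCMField.complexConj L) 3 V.Hm,
    UnitaryGroup.archAt (↥(maximalRealSubfield L)) L (IsCMField.complexConj L) 3 V.Hm (UnitaryGroup.cmPlace (L : Type) ι₁)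
        (NumberField.complexConj_smul_infinitePlace (L : Type) _) (IsCMField.complexConj_ne_one (L : Type)) a = 1 →
    ∀ ℓ, ((archSideOf V c hGR hGR₀ hGR₁ hGR₂ hGR₃ η hη hηc h₁W A).P 1).ω
        (HodgeCM.Adelic.regimeEquiv L V.Hm hV
          (UnitaryGroup.archToAdelic (↥(maximalRealSubfield L)) L (IsCMField.complexConj L) 3 V.Hm a), 1)
        (testFun (↥(maximalRealSubfield L)) (Fin 3)
          (blockFamilyOfAt (L : Type) e₁ (frameD V) (frameD_real V) (frameD_ne V) (lineVec (L : Type) (dW c.D 1))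
            (fun _ => dW_real c.D 1) (fun _ => dW_ne c.D 1) ι₁ (blockPosEquiv V) (blockNegEquiv V) eR₁' eS₁' (degOnePDual Empty) Φ₂ ℓ)
          (A 1).x₀ N) =
      testFun (↥(maximalRealSubfield L)) (Fin 3)
        (blockFamilyOfAt (L : Type) e₁ (frameD V) (frameD_real V) (frameD_ne V) (lineVec (L : Type) (dW c.D 1))
          (fun _ => dW_real c.D 1) (fun _ => dW_ne c.D 1) ι₁ (blockPosEquiv V) (blockNegEquiv V) eR₁' eS₁' (degOnePDual Empty) Φ₂ ℓ) (A 1).x₀ N)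
  (hfin₁' : ∀ kf : UnitaryGroup.finAdelic (↥(maximalRealSubfield L)) L (IsCMField.complexConj L) 3 V.Hm, kf ∈ Γ₀.K →
    ∀ Φinf : 𝓢((Fin 3 → mixedSpace (↥(maximalRealSubfield L))), ℂ),
      ((archSideOf V c hGR hGR₀ hGR₁ hGR₂ hGR₃ η hη hηc h₁W A).P 1).ω
          (HodgeCM.Adelic.regimeEquiv L V.Hm hV
            (UnitaryGroup.finAdelicToAdelic (↥(maximalRealSubfield L)) L (IsCMField.complexConj L) 3 V.Hm kf), 1)
          (testFun (↥(maximalRealSubfield L)) (Fin 3) Φinf (A 1).x₀ N) =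
        testFun (↥(maximalRealSubfield L)) (Fin 3) Φinf (A 1).x₀ N)
  (hsec₁' : ∀ u : stabilizer U21 x₀,
    cmBlockSectionAt (L : Type) (frameD V) (frameD_real V) (frameD_ne V) (lineVec (L : Type) (dW c.D 1)) (fun _ => dW_real c.D 1)
        (fun _ => dW_ne c.D 1) ι₁ (cmPlace (L : Type) ι₁) (blockPosEquiv V) (blockNegEquiv V) eR₁' eS₁' (u21FrameEquiv (u : U21), 1) =
      (archSectionFrameOf V u, 1))
  (hχ₁' : ∀ u : stabilizer U21 x₀,
    ((lineScalar_one V c.D hGR hGR₀ hGR₁ (eta₁ V c.D η) (u : U21) : ℂˣ) : ℂ) *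
        ((matA (stabilizerEquivK21.symm u)).det ^ (lineVacExponentsOne V c hGR₁ h₁W eR₁' eS₁').eP *
          sclD (stabilizerEquivK21.symm u) ^ (lineVacExponentsOne V c hGR₁ h₁W eR₁' eS₁').eQ) =
      star (sclD (stabilizerEquivK21.symm u)))
/-- **E's `C` at the honest S term in the literal slot at the exponent of record, `k`-dispatched.** -/
def archKTypeOfSlotRec (k : Fin 4) (hk : k = 0 ∨ k = 1) :
    ArchKTypeData (thetaSpaceInputIn hHD hI h₁ h₃ (archSideOf V c hGR hGR₀ hGR₁ hGR₂ hGR₃ η hη hηc h₁W A) hV) k N :=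
  if h0 : k = 0 then
    h0.symm ▸ archKTypeOfSlotZeroRec hHD hI h₁ h₃ V c hGR hGR₀ hGR₁ hGR₂ hGR₃ η hη hηc h₁W A hV N Γ₀ hlevel Φ₂ eR₀' eS₀' ℓ₀₀' arch₀₀' harch₀' hfin₀' hsec₀' hχ₀'
  else
    (hk.resolve_left h0).symm ▸ archKTypeOfSlotOneRec hHD hI h₁ h₃ V c hGR hGR₀ hGR₁ hGR₂ hGR₃ η hη hηc h₁W A hV N Γ₀ hlevel Φ₂ eR₁' eS₁' ℓ₀₁' arch₀₁' harch₁' hfin₁' hsec₁' hχ₁'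

set_option backward.isDefEq.respectTransparency false in
/-- **ROW 14 for it — no hypothesis beyond the two lines' inputs.** -/
theorem isWeaklyPDiff_archKTypeOfSlotRec (k : Fin 4) (hk : k = 0 ∨ k = 1) :
    (archKTypeOfSlotRec hHD hI h₁ h₃ V c hGR hGR₀ hGR₁ hGR₂ hGR₃ η hη hηc h₁W A hV N Γ₀ hlevel Φ₂ eR₀' eS₀' ℓ₀₀' arch₀₀' harch₀' hfin₀' hsec₀' hχ₀' eR₁' eS₁' ℓ₀₁' arch₀₁' harch₁' hfin₁' hsec₁' hχ₁' k hk).IsWeaklyPDiff BallForms.expP := by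
  unfold archKTypeOfSlotRec
  split
  · next h0 =>
    subst h0
    exact isWeaklyPDiff_archKTypeOfSlotZeroRec hHD hI h₁ h₃ V c hGR hGR₀ hGR₁ hGR₂ hGR₃ η hη hηc h₁W A hV N Γ₀ hlevel Φ₂ eR₀' eS₀' ℓ₀₀' arch₀₀' harch₀' hfin₀' hsec₀' hχ₀'
  · next h0 =>
    obtain rfl : k = 1 := hk.resolve_left h0
    exact isWeaklyPDiff_archKTypeOfSlotOneRec hHD hI h₁ h₃ V c hGR hGR₀ hGR₁ hGR₂ hGR₃ η hη hηc h₁W A hV N Γ₀ hlevel Φ₂ eR₁' eS₁' ℓ₀₁' arch₀₁' harch₁' hfin₁' hsec₁' hχ₁'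

end DispatchRec

end Record

end HodgeCM.Model

end
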